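import Mathlib
import HarnessLib
import Literature.NumberTheory.Transcendental.KZCalculus
import Literature.NumberTheory.Transcendental.KZLogCalculusProofs
import Literature.NumberTheory.Transcendental.MZVSimplexRepProofs
import Summits.KontsevichZagierPeriods.KontsevichZagierPeriods.Theorems.MzvKernelInKZ.Negative.Core
import Summits.KontsevichZagierPeriods.KontsevichZagierPeriods.Theorems.LinRedNormalFormDihedralNormalFormStubCellZetaMovesThreeAux2
import Summits.KontsevichZagierPeriods.KontsevichZagierPeriods.Theorems.LinRedNormalFormDihedralNormalFormStubCellZetaMovesThreeAux3
import Summits.KontsevichZagierPeriods.KontsevichZagierPeriods.Theorems.LinRedNormalFormDihedralNormalFormStubCellZetaMovesThreeAux4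

/-!
# Stub `stub_cellZetaMovesThree` of line `tame-bv-stokes` (crux `DihedralNormalForm`)

Registered stub `stub_cellZetaMovesThree` of the reduction skeleton of the crux `DihedralNormalForm`
(line `tame-bv-stokes`): the **cell `ℓ = 3`** of the cellular zeta reduction. `LogRep 3` is the
set of integral representations on the open ordered simplex `X = {1 > t₀ > t₁ > t₂ > 0}` whose
integrand agrees there with a `ℚ`-combination `Σ_f q_f ∏ᵢ 1/(tᵢ - a_{f,i})` of Arnold products
(letters decoded from `f i : Fin 5`: `0 ↦ 0`, `1 ↦ 1`, `v ≥ 2 ↦ t_{v-2}` if `v - 2 < i`, else the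
junk letter `0`). The claim: every element of `LogRep 3` lies in
`KZ.relations ⊔ ⟨MZV word representations⟩`.

Proof. Regrouping the 125 decoded products by fibres gives an Arnold combination `Φ_c` with
rational coefficient table `c` (`cellZeta3_regroup`); by the classification of tools IV its
absolute convergence forces `Φ_c = c₁·[0,0,1] + c₃·[0,1,1] + c₄·h₁ + c₅·h₂` on `X`
(`cellZeta3_final_form`), where `[0,0,1] = -ω₀ω₀ω₁` and `[0,1,1] = ω₀ω₁ω₁` are the `ζ(3)` and
`ζ(2,1)` words, `h₁ = 1/(t₀(t₁-1)(t₂-t₀))`, `h₂ = 1/(t₁(t₂-t₀)(t₂-1))`. The rotation `σ` of tools II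
pulls `h₁` back to `ω₀ω₁ω₁ + ω₀ω₀ω₁` and `h₂` back to `h₁`; so `[X, q·h₁]` EXISTS (transport of
absolute integrability) and is ONE change of variables away from the sum of two word
representations (one integrand-additivity move), and `[X, q·h₂]` exists and is one change of
variables away from `[X, q·h₁]` (`cellZeta3_exists_h₁/h₂`). Splitting `[X, Φ_c]` by iterated
integrand additivity (`KZ.of_sub_of_sub_sum_mem_relations`) into the two word representations and
`[X, c₄h₁]`, `[X, c₅h₂]` concludes (`cellZeta3_case_three`).

References: F. Brown, S. Carr, L. Schneps, *The algebra of cell-zeta values*, Compositio Math.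
146 (2010), §4.4.1 (`C(6)` is four-dimensional; the dihedral rotation); M. Kontsevich, D. Zagier,
*Periods* (2001), §§1.1–1.2.
-/

noncomputable section

open MeasureTheory Set MvPolynomial
open Literature.NumberTheory.Transcendental
open Literature.ModelTheory.ExponentialFields (IsSemialgebraic)
open Summit.KontsevichZagierPeriods.MzvKernelInKZ.Negative

namespace Summit.KontsevichZagierPeriods.DihedralNormalForm.TameBVStokes

/-! ### Regrouping the decoded products -/

/-- Decoding of the letter of the first coordinate: every value decodes to `0` or `1`.
[folklore] -/
theorem cellZeta3_decode0 (t : Fin 3 → ℝ) (v : Fin 5) :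
    (if ((v : Fin 5) : ℕ) = 0 then (0:ℝ) else if ((v : Fin 5) : ℕ) = 1 then 1
        else if h : ((v : Fin 5) : ℕ) - 2 < ((0 : Fin 3) : ℕ) then
          t ⟨((v : Fin 5) : ℕ) - 2, lt_trans h (0 : Fin 3).isLt⟩ else 0) =
    (![0, 1] : Fin 2 → ℝ) ((![0, 1, 0, 0, 0] : Fin 5 → Fin 2) v) := by
  fin_cases v <;> simp

/-- Decoding of the letter of the second coordinate: `0, 1, t₀`. [folklore] -/
theorem cellZeta3_decode1 (t : Fin 3 → ℝ) (v : Fin 5) :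
    (if ((v : Fin 5) : ℕ) = 0 then (0:ℝ) else if ((v : Fin 5) : ℕ) = 1 then 1
        else if h : ((v : Fin 5) : ℕ) - 2 < ((1 : Fin 3) : ℕ) then
          t ⟨((v : Fin 5) : ℕ) - 2, lt_trans h (1 : Fin 3).isLt⟩ else 0) =
    (![0, 1, t 0] : Fin 3 → ℝ) ((![0, 1, 2, 0, 0] : Fin 5 → Fin 3) v) := by
  fin_cases v <;> simp

/-- Decoding of the letter of the third coordinate: `0, 1, t₀, t₁`. [folklore] -/
theorem cellZeta3_decode2 (t : Fin 3 → ℝ) (v : Fin 5) :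
    (if ((v : Fin 5) : ℕ) = 0 then (0:ℝ) else if ((v : Fin 5) : ℕ) = 1 then 1
        else if h : ((v : Fin 5) : ℕ) - 2 < ((2 : Fin 3) : ℕ) then
          t ⟨((v : Fin 5) : ℕ) - 2, lt_trans h (2 : Fin 3).isLt⟩ else 0) =
    (![0, 1, t 0, t 1] : Fin 4 → ℝ) ((![0, 1, 2, 3, 0] : Fin 5 → Fin 4) v) := by
  fin_cases v <;> simp

/-- **Regrouping in dimension three.** The 125 decoded Arnold products regroup into the 24-term
Arnold combination whose coefficients are the fibre sums of `q`. [folklore] -/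
theorem cellZeta3_regroup (q : (Fin 3 → Fin 5) → ℚ) (t : Fin 3 → ℝ) :
    (∑ f : Fin 3 → Fin 5, (q f : ℝ) * ∏ i : Fin 3, 1 / (t i -
      (if ((f i : Fin 5) : ℕ) = 0 then (0:ℝ) else if ((f i : Fin 5) : ℕ) = 1 then 1
        else if h : ((f i : Fin 5) : ℕ) - 2 < (i : ℕ) then
          t ⟨((f i : Fin 5) : ℕ) - 2, lt_trans h i.isLt⟩ else 0))) =
    ∑ a : Fin 2, ∑ b : Fin 3, ∑ d : Fin 4,
      ((∑ f : Fin 3 → Fin 5 with ((![0, 1, 0, 0, 0] : Fin 5 → Fin 2) (f 0),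
          (![0, 1, 2, 0, 0] : Fin 5 → Fin 3) (f 1), (![0, 1, 2, 3, 0] : Fin 5 → Fin 4) (f 2)) = (a, b, d),
          q f : ℚ) : ℝ) *
      ((1 / (t 0 - (![0, 1] : Fin 2 → ℝ) a)) * (1 / (t 1 - (![0, 1, t 0] : Fin 3 → ℝ) b)) *
        (1 / (t 2 - (![0, 1, t 0, t 1] : Fin 4 → ℝ) d))) := by
  have h1 : ∀ f : Fin 3 → Fin 5, (∏ i : Fin 3, 1 / (t i -
      (if ((f i : Fin 5) : ℕ) = 0 then (0:ℝ) else if ((f i : Fin 5) : ℕ) = 1 then 1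
        else if h : ((f i : Fin 5) : ℕ) - 2 < (i : ℕ) then
          t ⟨((f i : Fin 5) : ℕ) - 2, lt_trans h i.isLt⟩ else 0))) =
      (1 / (t 0 - (![0, 1] : Fin 2 → ℝ) ((![0, 1, 0, 0, 0] : Fin 5 → Fin 2) (f 0)))) *
      (1 / (t 1 - (![0, 1, t 0] : Fin 3 → ℝ) ((![0, 1, 2, 0, 0] : Fin 5 → Fin 3) (f 1)))) *
      (1 / (t 2 - (![0, 1, t 0, t 1] : Fin 4 → ℝ) ((![0, 1, 2, 3, 0] : Fin 5 → Fin 4) (f 2)))) := by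
    intro f
    rw [Fin.prod_univ_three, ← cellZeta3_decode0 t (f 0), ← cellZeta3_decode1 t (f 1),
      ← cellZeta3_decode2 t (f 2)]
  simp_rw [h1]
  rw [← Finset.sum_fiberwise Finset.univ (fun f : Fin 3 → Fin 5 =>
    (((![0, 1, 0, 0, 0] : Fin 5 → Fin 2) (f 0),
          (![0, 1, 2, 0, 0] : Fin 5 → Fin 3) (f 1), (![0, 1, 2, 3, 0] : Fin 5 → Fin 4) (f 2)) : Fin 2 × Fin 3 × Fin 4))]
  simp_rw [Fintype.sum_prod_type]
  refine Finset.sum_congr rfl fun a _ => Finset.sum_congr rfl fun b _ =>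
    Finset.sum_congr rfl fun d _ => ?_
  rw [Rat.cast_sum, Finset.sum_mul]
  refine Finset.sum_congr rfl fun f hf => ?_
  obtain ⟨-, hf⟩ := Finset.mem_filter.1 hf
  simp only [Prod.mk.injEq] at hf
  rw [hf.1, hf.2.1, hf.2.2]

/-! ### The final form of a convergent combination -/

/-- **The final form.** Under the twenty conditions of the classification, on the simplex
`Φ_c = c₀₀₁·[0,0,1] + c₀₁₁·[0,1,1] + c₀₁₂·h₁ + c₁₀₂·h₂` with `h₁ = 1/(t₀(t₁-1)(t₂-t₀))` and
`h₂ = [1,0,t₀] - [1,0,1] = 1/(t₁(t₂-t₀)(t₂-1))`. [folklore] -/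
theorem cellZeta3_final_form (c : Fin 2 → Fin 3 → Fin 4 → ℝ)
    (h : c 0 0 0 = 0 ∧ c 0 0 2 = 0 ∧ c 0 0 3 = 0 ∧ c 0 1 0 = 0 ∧ c 0 1 3 = 0 ∧ c 0 2 0 = 0 ∧
      c 0 2 1 = 0 ∧ c 0 2 2 = 0 ∧ c 0 2 3 = 0 ∧ c 1 0 0 = 0 ∧ c 1 0 1 = -c 1 0 2 ∧ c 1 0 3 = 0 ∧
      c 1 1 0 = 0 ∧ c 1 1 1 = 0 ∧ c 1 1 2 = 0 ∧ c 1 1 3 = 0 ∧ c 1 2 0 = 0 ∧ c 1 2 1 = 0 ∧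
      c 1 2 2 = 0 ∧ c 1 2 3 = 0)
    (t : Fin 3 → ℝ) (ht : t ∈ {t : Fin 3 → ℝ | (∀ i, 0 < t i) ∧ (∀ i, t i < 1) ∧ StrictAnti t}) :
    (∑ a : Fin 2, ∑ b : Fin 3, ∑ d : Fin 4, c a b d *
        ((1 / (t 0 - (![0, 1] : Fin 2 → ℝ) a)) * (1 / (t 1 - (![0, 1, t 0] : Fin 3 → ℝ) b)) *
          (1 / (t 2 - (![0, 1, t 0, t 1] : Fin 4 → ℝ) d)))) =
    c 0 0 1 * (1 / t 0 * (1 / t 1) * (1 / (t 2 - 1))) +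
      c 0 1 1 * (1 / t 0 * (1 / (t 1 - 1)) * (1 / (t 2 - 1))) +
      c 0 1 2 * (1 / (t 0 * (t 1 - 1) * (t 2 - t 0))) +
      c 1 0 2 * (1 / (t 1 * (t 2 - t 0) * (t 2 - 1))) := by
  obtain ⟨e000, e002, e003, e010, e013, e020, e021, e022, e023, e100, e101, e103, e110, e111, e112, e113, e120, e121, e122, e123⟩ := h
  obtain ⟨n0, n1, n2, n02, n12, n01, n11, n21, n10, n20, n21', n2m1⟩ := cellZeta3_ne_zero ht
  simp only [Fin.sum_univ_two, Fin.sum_univ_three, Fin.sum_univ_four, Matrix.cons_val_zero,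
    Matrix.cons_val_one, Matrix.cons_val_two, Matrix.cons_val_three, Matrix.head_cons,
    Matrix.tail_cons, sub_zero, e000, e002, e003, e010, e013, e020, e021, e022, e023, e100, e101, e103, e110, e111, e112, e113, e120, e121, e122, e123]
  field_simp
  ring

/-! ### The two non-word functions `h₁`, `h₂`: existence and moves -/

/-- The source of the `h₁` move exists and lies in the target subgroup: `[X, q·ω₀ω₁ω₁ + q·ω₀ω₀ω₁]`
is one integrand-additivity move away from two word representations. [folklore] -/
theorem cellZeta3_exists_g (q : ℚ) :
    ∃ G : KZ.IntegralRep 3, G.domain = {t : Fin 3 → ℝ | (∀ i, 0 < t i) ∧ (∀ i, t i < 1) ∧ StrictAnti t} ∧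
      G.integrand = (fun t => wordFun ![false, true, true] q t + wordFun ![false, false, true] q t) ∧
      KZ.of G ∈ KZ.relations ⊔ AddSubgroup.closure genSet := by
  have hA1 : Adm ![false, true, true] := by decide
  have hA2 : Adm ![false, false, true] := by decide
  let G : KZ.IntegralRep 3 :=
    ⟨{t : Fin 3 → ℝ | (∀ i, 0 < t i) ∧ (∀ i, t i < 1) ∧ StrictAnti t},
      fun t => wordFun ![false, true, true] q t + wordFun ![false, false, true] q t,
      KZ.isSemialgebraic_openOrderedSimplex 3,
      IsSemialgebraicFunOn.add_holds (isSemialgebraicFunOn_wordFun _ q)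
        (isSemialgebraicFunOn_wordFun _ q),
      (integrableOn_wordFun hA1 q).add (integrableOn_wordFun hA2 q)⟩
  have h1 : KZ.of G - KZ.of (wordRep _ q hA1) - KZ.of (wordRep _ q hA2) ∈ KZ.relations :=
    KZ.integrandAddRel_subset_relations ⟨3, G, wordRep _ q hA1, wordRep _ q hA2, rfl, rfl,
      fun t _ => rfl, rfl⟩
  refine ⟨G, rfl, rfl, ?_⟩
  have : KZ.of G = (KZ.of G - KZ.of (wordRep _ q hA1) - KZ.of (wordRep _ q hA2)) +
      KZ.of (wordRep _ q hA1) + KZ.of (wordRep _ q hA2) := by abel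
  rw [this]
  exact add_mem (add_mem (AddSubgroup.mem_sup_left h1)
    (AddSubgroup.mem_sup_right (of_wordRep_mem_closure _ q hA1)))
    (AddSubgroup.mem_sup_right (of_wordRep_mem_closure _ q hA2))

/-- The pull-back identity for `h₁`: `(q h₁ ∘ σ)·|J| = q·ω₀ω₁ω₁ + q·ω₀ω₀ω₁` on the simplex.
[folklore] -/
theorem cellZeta3_pull_h₁ (q : ℚ) {y : Fin 3 → ℝ} (hy : y ∈ {t : Fin 3 → ℝ | (∀ i, 0 < t i) ∧ (∀ i, t i < 1) ∧ StrictAnti t}) :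
    wordFun ![false, true, true] q y + wordFun ![false, false, true] q y =
      (fun u : Fin 3 → ℝ => (q : ℝ) * (1 / (u 0 * (u 1 - 1) * (u 2 - u 0))))
        ![1 - y 2, (y 0 - y 2) / y 0, (y 1 - y 2) / y 1] * (y 2 ^ 2 / (y 0 ^ 2 * y 1 ^ 2)) := by
  obtain ⟨n0, n1, n2, n02, n12, n01, n11, n21, n10, n20, n21', n2m1⟩ := cellZeta3_ne_zero hy
  have n1' : 1 - y 1 ≠ 0 := fun h => n11 (by linarith)
  have e1 : (y 0 - y 2) / y 0 - 1 = -y 2 / y 0 := by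
    field_simp
    ring
  have e2 : (y 1 - y 2) / y 1 - (1 - y 2) = y 2 * (y 1 - 1) / y 1 := by
    field_simp
    ring
  simp only [wordFun, Fin.prod_univ_three, Matrix.cons_val_zero, Matrix.cons_val_one,
    Matrix.cons_val_two, Matrix.head_cons, Matrix.tail_cons, Bool.false_eq_true, if_false, if_true]
  rw [e1, e2]
  field_simp
  ring

/-- The pull-back identity for `h₂`: `(q h₂ ∘ σ)·|J| = q h₁` on the simplex. [folklore] -/
theorem cellZeta3_pull_h₂ (q : ℚ) {y : Fin 3 → ℝ} (hy : y ∈ {t : Fin 3 → ℝ | (∀ i, 0 < t i) ∧ (∀ i, t i < 1) ∧ StrictAnti t}) :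
    (q : ℝ) * (1 / (y 0 * (y 1 - 1) * (y 2 - y 0))) =
      (fun u : Fin 3 → ℝ => (q : ℝ) * (1 / (u 1 * (u 2 - u 0) * (u 2 - 1))))
        ![1 - y 2, (y 0 - y 2) / y 0, (y 1 - y 2) / y 1] * (y 2 ^ 2 / (y 0 ^ 2 * y 1 ^ 2)) := by
  obtain ⟨n0, n1, n2, n02, n12, n01, n11, n21, n10, n20, n21', n2m1⟩ := cellZeta3_ne_zero hy
  have e2 : (y 1 - y 2) / y 1 - (1 - y 2) = y 2 * (y 1 - 1) / y 1 := by
    field_simp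
    ring
  have e3 : (y 1 - y 2) / y 1 - 1 = -y 2 / y 1 := by
    field_simp
    ring
  simp only [Matrix.cons_val_zero, Matrix.cons_val_one, Matrix.cons_val_two, Matrix.head_cons,
    Matrix.tail_cons]
  rw [e2, e3]
  field_simp
  ring

/-- **`[X, q·h₁]` exists and lies in `relations ⊔ ⟨words⟩`**: absolute integrability of `q h₁` is
transported along `σ` from the two words, and ONE change of variables joins them.
[cite: KontsevichZagier2001, §1.2 rule (2)] -/
theorem cellZeta3_exists_h₁ (q : ℚ) :
    ∃ H : KZ.IntegralRep 3, H.domain = {t : Fin 3 → ℝ | (∀ i, 0 < t i) ∧ (∀ i, t i < 1) ∧ StrictAnti t} ∧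
      H.integrand = (fun u : Fin 3 → ℝ => (q : ℝ) * (1 / (u 0 * (u 1 - 1) * (u 2 - u 0)))) ∧
      KZ.of H ∈ KZ.relations ⊔ AddSubgroup.closure genSet := by
  obtain ⟨G, hGd, hGi, hGm⟩ := cellZeta3_exists_g q
  obtain ⟨-, hT2, hT3⟩ := cellZeta3_sigma_transport
    (fun u : Fin 3 → ℝ => (q : ℝ) * (1 / (u 0 * (u 1 - 1) * (u 2 - u 0))))
  have hGeq : EqOn G.integrand (fun y => (fun u : Fin 3 → ℝ => (q : ℝ) *
      (1 / (u 0 * (u 1 - 1) * (u 2 - u 0)))) ![1 - y 2, (y 0 - y 2) / y 0, (y 1 - y 2) / y 1] *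
      (y 2 ^ 2 / (y 0 ^ 2 * y 1 ^ 2))) G.domain := by
    rw [hGd]
    intro y hy
    rw [hGi]
    exact cellZeta3_pull_h₁ q hy
  have hint := hT2 G hGd hGeq
  have hne : ∀ x ∈ {t : Fin 3 → ℝ | (∀ i, 0 < t i) ∧ (∀ i, t i < 1) ∧ StrictAnti t},
      aeval x (X 0 * (X 1 - 1) * (X 2 - X 0) : MvPolynomial (Fin 3) ℚ) ≠ 0 := by
    intro x hx
    obtain ⟨n0, n1, n2, n02, n12, n01, n11, n21, n10, n20, n21', n2m1⟩ := cellZeta3_ne_zero hx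
    simp only [map_mul, map_sub, map_one, aeval_X]
    exact mul_ne_zero (mul_ne_zero n0 n11) n20
  have hsa : IsSemialgebraicFunOn ℚ {t : Fin 3 → ℝ | (∀ i, 0 < t i) ∧ (∀ i, t i < 1) ∧ StrictAnti t}
      (fun u : Fin 3 → ℝ => (q : ℝ) * (1 / (u 0 * (u 1 - 1) * (u 2 - u 0)))) := by
    refine (isSemialgebraicFunOn_aeval_div_aeval (KZ.isSemialgebraic_openOrderedSimplex 3)
      (C q) (X 0 * (X 1 - 1) * (X 2 - X 0)) hne).congr fun u _ => ?_
    simp only [map_mul, map_sub, map_one, aeval_X, aeval_C, eq_ratCast]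
    ring
  let H : KZ.IntegralRep 3 := ⟨_, _, KZ.isSemialgebraic_openOrderedSimplex 3, hsa, hint⟩
  have hmove : KZ.of G - KZ.of H ∈ KZ.relations := hT3 G H hGd hGeq rfl fun _ _ => rfl
  refine ⟨H, rfl, rfl, ?_⟩
  have : KZ.of H = KZ.of G - (KZ.of G - KZ.of H) := by abel
  rw [this]
  exact sub_mem hGm (AddSubgroup.mem_sup_left hmove)

/-- **`[X, q·h₂]` exists and lies in `relations ⊔ ⟨words⟩`**: absolute integrability of `q h₂` is
transported along `σ` from `q h₁`, and ONE change of variables joins `[X, q h₁]` to `[X, q h₂]`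
(this is the cellular form of `ζ(2,1) = ζ(3)`). [cite: KontsevichZagier2001, §1.2 rule (2)] -/
theorem cellZeta3_exists_h₂ (q : ℚ) :
    ∃ H : KZ.IntegralRep 3, H.domain = {t : Fin 3 → ℝ | (∀ i, 0 < t i) ∧ (∀ i, t i < 1) ∧ StrictAnti t} ∧
      H.integrand = (fun u : Fin 3 → ℝ => (q : ℝ) * (1 / (u 1 * (u 2 - u 0) * (u 2 - 1)))) ∧
      KZ.of H ∈ KZ.relations ⊔ AddSubgroup.closure genSet := by
  obtain ⟨G, hGd, hGi, hGm⟩ := cellZeta3_exists_h₁ q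
  obtain ⟨-, hT2, hT3⟩ := cellZeta3_sigma_transport
    (fun u : Fin 3 → ℝ => (q : ℝ) * (1 / (u 1 * (u 2 - u 0) * (u 2 - 1))))
  have hGeq : EqOn G.integrand (fun y => (fun u : Fin 3 → ℝ => (q : ℝ) *
      (1 / (u 1 * (u 2 - u 0) * (u 2 - 1)))) ![1 - y 2, (y 0 - y 2) / y 0, (y 1 - y 2) / y 1] *
      (y 2 ^ 2 / (y 0 ^ 2 * y 1 ^ 2))) G.domain := by
    rw [hGd]
    intro y hy
    rw [hGi]
    exact cellZeta3_pull_h₂ q hy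
  have hint := hT2 G hGd hGeq
  have hne : ∀ x ∈ {t : Fin 3 → ℝ | (∀ i, 0 < t i) ∧ (∀ i, t i < 1) ∧ StrictAnti t},
      aeval x (X 1 * (X 2 - X 0) * (X 2 - 1) : MvPolynomial (Fin 3) ℚ) ≠ 0 := by
    intro x hx
    obtain ⟨n0, n1, n2, n02, n12, n01, n11, n21, n10, n20, n21', n2m1⟩ := cellZeta3_ne_zero hx
    simp only [map_mul, map_sub, map_one, aeval_X]
    exact mul_ne_zero (mul_ne_zero n1 n20) n2m1
  have hsa : IsSemialgebraicFunOn ℚ {t : Fin 3 → ℝ | (∀ i, 0 < t i) ∧ (∀ i, t i < 1) ∧ StrictAnti t}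
      (fun u : Fin 3 → ℝ => (q : ℝ) * (1 / (u 1 * (u 2 - u 0) * (u 2 - 1)))) := by
    refine (isSemialgebraicFunOn_aeval_div_aeval (KZ.isSemialgebraic_openOrderedSimplex 3)
      (C q) (X 1 * (X 2 - X 0) * (X 2 - 1)) hne).congr fun u _ => ?_
    simp only [map_mul, map_sub, map_one, aeval_X, aeval_C, eq_ratCast]
    ring
  let H : KZ.IntegralRep 3 := ⟨_, _, KZ.isSemialgebraic_openOrderedSimplex 3, hsa, hint⟩
  have hmove : KZ.of G - KZ.of H ∈ KZ.relations := hT3 G H hGd hGeq rfl fun _ _ => rfl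
  refine ⟨H, rfl, rfl, ?_⟩
  have : KZ.of H = KZ.of G - (KZ.of G - KZ.of H) := by abel
  rw [this]
  exact sub_mem hGm (AddSubgroup.mem_sup_left hmove)

/-! ### The cell `ℓ = 3` -/

/-- **The cell `ℓ = 3`.** A representation on the open 3-simplex whose integrand is a convergent
`ℚ`-combination of decoded Arnold products lies in `relations ⊔ ⟨word representations⟩`.
[cite: KontsevichZagier2001, §1.2] -/
theorem cellZeta3_case_three (q : (Fin 3 → Fin 5) → ℚ) (s : KZ.IntegralRep 3)
    (hdom : s.domain = {t : Fin 3 → ℝ | (∀ i, 0 < t i) ∧ (∀ i, t i < 1) ∧ StrictAnti t})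
    (hint : EqOn s.integrand (fun t => ∑ f : Fin 3 → Fin 5, (q f : ℝ) * ∏ i : Fin 3, 1 / (t i -
      (if ((f i : Fin 5) : ℕ) = 0 then (0:ℝ) else if ((f i : Fin 5) : ℕ) = 1 then 1
        else if h : ((f i : Fin 5) : ℕ) - 2 < (i : ℕ) then
          t ⟨((f i : Fin 5) : ℕ) - 2, lt_trans h i.isLt⟩ else 0))) s.domain) :
    KZ.of s ∈ KZ.relations ⊔ AddSubgroup.closure genSet := by
  -- the coefficient table
  set cq : Fin 2 → Fin 3 → Fin 4 → ℚ := fun a b d =>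
    ∑ f : Fin 3 → Fin 5 with ((![0, 1, 0, 0, 0] : Fin 5 → Fin 2) (f 0),
          (![0, 1, 2, 0, 0] : Fin 5 → Fin 3) (f 1), (![0, 1, 2, 3, 0] : Fin 5 → Fin 4) (f 2)) = (a, b, d), q f with hcq
  have hΦ : EqOn s.integrand (fun u : Fin 3 → ℝ => ∑ a : Fin 2, ∑ b : Fin 3, ∑ d : Fin 4,
      ((cq a b d : ℚ) : ℝ) *
        ((1 / (u 0 - (![0, 1] : Fin 2 → ℝ) a)) * (1 / (u 1 - (![0, 1, u 0] : Fin 3 → ℝ) b)) *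
          (1 / (u 2 - (![0, 1, u 0, u 1] : Fin 4 → ℝ) d)))) {t : Fin 3 → ℝ | (∀ i, 0 < t i) ∧ (∀ i, t i < 1) ∧ StrictAnti t} := by
    intro t ht
    rw [hint (show t ∈ s.domain by rw [hdom]; exact ht)]
    exact cellZeta3_regroup q t
  have hcl := cellZeta3_classification (fun a b d => ((cq a b d : ℚ) : ℝ)) ⟨s, hdom, hΦ⟩
  have hA1 : Adm ![false, false, true] := by decide
  have hA3 : Adm ![false, true, true] := by decide
  obtain ⟨H1, hH1d, hH1i, hH1m⟩ := cellZeta3_exists_h₁ (cq 0 1 2)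
  obtain ⟨H2, hH2d, hH2i, hH2m⟩ := cellZeta3_exists_h₂ (cq 1 0 2)
  have hsplit : KZ.of s - KZ.of (wordRep _ (-(cq 0 0 1)) hA1) -
      ∑ i : Fin 3, KZ.of ((![wordRep _ (cq 0 1 1) hA3, H1, H2] : Fin 3 → KZ.IntegralRep 3) i) ∈
      KZ.relations := by
    refine KZ.of_sub_of_sub_sum_mem_relations 3 s (wordRep _ (-(cq 0 0 1)) hA1)
      ![wordRep _ (cq 0 1 1) hA3, H1, H2] (by rw [hdom]; rfl) (fun i => ?_) (fun t ht => ?_)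
    · fin_cases i
      · show (wordRep _ (cq 0 1 1) hA3).domain = s.domain
        rw [hdom]; rfl
      · show H1.domain = s.domain
        rw [hdom, hH1d]
      · show H2.domain = s.domain
        rw [hdom, hH2d]
    · have ht' : t ∈ {t : Fin 3 → ℝ | (∀ i, 0 < t i) ∧ (∀ i, t i < 1) ∧ StrictAnti t} := by
        rw [← hdom]; exact ht
      obtain ⟨n0, n1, n2, n02, n12, n01, n11, n21, n10, n20, n21', n2m1⟩ := cellZeta3_ne_zero ht'
      have n1' : 1 - t 1 ≠ 0 := fun h => n11 (by linarith)
      rw [hΦ ht']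
      beta_reduce
      rw [cellZeta3_final_form _ hcl t ht', Fin.sum_univ_three]
      simp only [Matrix.cons_val_zero, Matrix.cons_val_one, Matrix.cons_val_two, Matrix.head_cons,
        Matrix.tail_cons, wordRep_integrand, hH1i, hH2i]
      simp only [wordFun, Fin.prod_univ_three, Matrix.cons_val_zero, Matrix.cons_val_one,
        Matrix.cons_val_two, Matrix.head_cons, Matrix.tail_cons, Bool.false_eq_true, if_false,
        if_true, Rat.cast_neg]
      field_simp
      ring
  have hW1 := of_wordRep_mem_closure _ (-(cq 0 0 1)) hA1
  have hW3 := of_wordRep_mem_closure _ (cq 0 1 1) hA3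
  rw [Fin.sum_univ_three] at hsplit
  simp only [Matrix.cons_val_zero, Matrix.cons_val_one, Matrix.cons_val_two, Matrix.head_cons,
    Matrix.tail_cons] at hsplit
  have : KZ.of s = (KZ.of s - KZ.of (wordRep _ (-(cq 0 0 1)) hA1) -
      (KZ.of (wordRep _ (cq 0 1 1) hA3) + KZ.of H1 + KZ.of H2)) +
      KZ.of (wordRep _ (-(cq 0 0 1)) hA1) + (KZ.of (wordRep _ (cq 0 1 1) hA3) + KZ.of H1 + KZ.of H2) := by
    abel
  rw [this]
  exact add_mem (add_mem (AddSubgroup.mem_sup_left hsplit) (AddSubgroup.mem_sup_right hW1))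
    (add_mem (add_mem (AddSubgroup.mem_sup_right hW3) hH1m) hH2m)

/-! ### The registered stub -/

/-- **Stub `stub_cellZetaMovesThree`** (line `tame-bv-stokes`, crux `DihedralNormalForm`): every
representation on the open ordered 3-simplex whose integrand is a convergent `ℚ`-combination of
decoded Arnold products lies in `KZ.relations ⊔ ⟨MZV word representations⟩` — it is moved, by
integrand additivity and the dihedral rotation (one change of variables per use), to the `ζ(3)`
and `ζ(2,1)` words. [cite: KontsevichZagier2001, §1.2] -/
theorem stub_cellZetaMovesThree (LogRep : ℕ → Set Literature.NumberTheory.Transcendental.KZ.FormalRep) (hLogRep : ∀ ℓ, LogRep ℓ = {y : Literature.NumberTheory.Transcendental.KZ.FormalRep | ∃ (q : (Fin ℓ → Fin (ℓ + 2)) → ℚ) (s : Literature.NumberTheory.Transcendental.KZ.IntegralRep ℓ), s.domain = {t : Fin ℓ → ℝ | (∀ i, 0 < t i) ∧ (∀ i, t i < 1) ∧ StrictAnti t} ∧ Set.EqOn s.integrand (fun t => ∑ f : Fin ℓ → Fin (ℓ + 2), (q f : ℝ) * ∏ i : Fin ℓ, 1 / (t i - (if ((f i : Fin (ℓ + 2))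 : ℕ) = 0 then (0:ℝ) else if ((f i : Fin (ℓ + 2)) : ℕ) = 1 then 1 else if h : ((f i : Fin (ℓ + 2)) : ℕ) - 2 < (i : ℕ) then t ⟨((f i : Fin (ℓ + 2)) : ℕ) - 2, lt_trans h i.isLt⟩ else 0))) s.domain ∧ y = Literature.NumberTheory.Transcendental.KZ.of s}) : ∀ y ∈ LogRep 3, y ∈ Literature.NumberTheory.Transcendental.KZ.relations ⊔ AddSubgroup.closure {x : Literature.NumberTheory.Transcendental.KZ.FormalRep | ∃ (w : ℕ) (ε : Fin w → Bool) (q : ℚ) (s : Literature.NumberTheory.Transcendental.KZ.IntegralRep w), s.domain = {t : Fin w → ℝ | (∀ i, 0 < t i) ∧ (∀ i, t i < 1) ∧ StrictAnti t} ∧ Set.EqOn s.integrand (fun t => (q : ℝ) * ∏ i, if ε i then 1 / (1 - t i) else 1 / t i) s.domain ∧ x = Literature.NumberTheory.Transcendental.KZ.of s} := by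
  intro y hy
  rw [hLogRep] at hy
  obtain ⟨q, s, hdom, hint, rfl⟩ := hy
  exact cellZeta3_case_three q s hdom hint

end Summit.KontsevichZagierPeriods.DihedralNormalForm.TameBVStokes
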